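import Mathlib
import HarnessLib
import Summits.NavierStokesRegularity.NavierStokesRegularity.Theses.RellichScar
import Summits.NavierStokesRegularity.NavierStokesRegularity.Theorems.RellichScarDefs
import Literature.Analysis.FluidPDE.TypeIAncientMild

/-!
# Sketch — first lemmas of the crux idea `horizon-observability-splitting`
(crux-ideate round 2, ideator 4, crux `stmt-NavierStokesRegularity-11717` = `RellichScar.ScarRigidity`)

Nothing below is a proof of the crux.  The definitions are the FIRST CHECKABLE STATEMENTS of the line; the two
`theorem`s are pure-logic glue showing how they slot into the landed reduction
`scarRigidity_of_allOrdersFlat_of_flatRigidity : AOF → FSR → ScarRigidity`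
(`Theorems/RellichScarScarRigidityScarTwinsFlatness.lean`, p123667): FSR ⟸ ExteriorTwinVanishing ⟸
ParaboloidExteriorTwinVanishing ∧ TwinSpatialUniqueContinuation.
-/

noncomputable section

namespace Summit.NavierStokesRegularity.NavierStokesRegularity.Cruxes.ScarRigidity.SketchIdeator4

open MeasureTheory Filter Set Function
open scoped Laplacian
open Literature.Analysis.FluidPDE
open Summit.NavierStokesRegularity.NavierStokesRegularity.Theorems.RellichScarScarRigidity

local notation "ℝ³" => EuclideanSpace ℝ (Fin 3)

/-- **FSR verbatim**: the second hypothesis of the landed reduction `scarRigidity_of_allOrdersFlat_of_flatRigidity`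
(= registered `stub_flatScarRigidity` of the dead line moment-conditioned-rellich): all-orders-flat scar twins coincide. -/
def FSR : Prop :=
  ∀ (V₁ V₂ : ℝ → ℝ³ → ℝ³) (Q₁ Q₂ : ℝ → ℝ³ → ℝ) (C : ℝ), 0 < C →
    IsTypeIAncientMild C V₁ → IsTypeIAncientMild C V₂ → HasTypeIDecay C V₁ → HasTypeIDecay C V₂ →
    IsClassicalNSSolutionOn (Iio (0 : ℝ)) 1 0 V₁ Q₁ → IsClassicalNSSolutionOn (Iio (0 : ℝ)) 1 0 V₂ Q₂ →
    ScaleInvariantBounds V₁ Q₁ → ScaleInvariantBounds V₂ Q₂ →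
    IsBackwardSingularPoint V₁ 0 → IsBackwardSingularPoint V₂ 0 →
    (∀ N : ℕ, FarDecay N V₁ V₂) → ∀ t < 0, ∀ x : ℝ³, V₁ t x = V₂ t x

/-- **ExteriorTwinVanishing** (the honest residual isolated by lead a1's FSR analysis, `Lines/moment-conditioned-
rellich-FSR-analysis.md` §6, verbatim): all-orders-flat twins agree on `{‖x‖ ≥ R}` for every `R > 0`. -/
def ExteriorTwinVanishing : Prop :=
  ∀ (V₁ V₂ : ℝ → ℝ³ → ℝ³) (Q₁ Q₂ : ℝ → ℝ³ → ℝ) (C : ℝ), 0 < C →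
    IsTypeIAncientMild C V₁ → IsTypeIAncientMild C V₂ → HasTypeIDecay C V₁ → HasTypeIDecay C V₂ →
    IsClassicalNSSolutionOn (Iio (0 : ℝ)) 1 0 V₁ Q₁ → IsClassicalNSSolutionOn (Iio (0 : ℝ)) 1 0 V₂ Q₂ →
    ScaleInvariantBounds V₁ Q₁ → ScaleInvariantBounds V₂ Q₂ →
    IsBackwardSingularPoint V₁ 0 → IsBackwardSingularPoint V₂ 0 →
    (∀ N : ℕ, FarDecay N V₁ V₂) →
    ∀ R : ℝ, 0 < R → ∀ t < 0, ∀ x : ℝ³, R ≤ ‖x‖ → V₁ t x = V₂ t x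

/-- **(L1) PARABOLOID-EXTERIOR TWIN VANISHING** — the statement the new lever proves: there is a geometric radius
`R₀ = R₀(C)` such that all-orders-flat twins agree OUTSIDE THE SIMILARITY HORIZON `‖x‖ ≥ R₀ √(−t)` (in Leray variables:
on `{‖y‖ ≥ R₀} × ℝ`, where the twin coupling is a short-range `O(C/‖y‖²)` perturbation of the Leray transport; no
smallness of `C`, no statement on the core).  Lever: angular observability splitting (modes `ℓ ≲ ‖y‖` are read from
infinity with bounded loss `e^{ℓ²/‖y‖²}` — the explicit correction of the slow Kummer branch —, modes `ℓ ≫ ‖y‖` are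
diffusively slaved because the twins are eternal) + inward Volterra iteration. -/
def ParaboloidExteriorTwinVanishing : Prop :=
  ∀ C : ℝ, 0 < C → ∃ R₀ : ℝ, 0 < R₀ ∧
    ∀ (V₁ V₂ : ℝ → ℝ³ → ℝ³) (Q₁ Q₂ : ℝ → ℝ³ → ℝ),
      IsTypeIAncientMild C V₁ → IsTypeIAncientMild C V₂ → HasTypeIDecay C V₁ → HasTypeIDecay C V₂ →
      IsClassicalNSSolutionOn (Iio (0 : ℝ)) 1 0 V₁ Q₁ → IsClassicalNSSolutionOn (Iio (0 : ℝ)) 1 0 V₂ Q₂ →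
      ScaleInvariantBounds V₁ Q₁ → ScaleInvariantBounds V₂ Q₂ →
      (∀ N : ℕ, FarDecay N V₁ V₂) →
      ∀ t < 0, ∀ x : ℝ³, R₀ * Real.sqrt (-t) ≤ ‖x‖ → V₁ t x = V₂ t x

/-- **(L2) TWIN SPATIAL UNIQUE CONTINUATION at regular times** (known mathematics: spatial analyticity of classical
Navier–Stokes solutions — Masuda 1967, Kahane 1969, tree `NSBoundedMildAnalytic` pattern — or Fabre–Lebeau 1996 UC for
the linearised Stokes system): two classical solutions on the open past that agree outside SOME ball at a time `t < 0`
agree everywhere at that time. -/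
def TwinSpatialUniqueContinuation : Prop :=
  ∀ (V₁ V₂ : ℝ → ℝ³ → ℝ³) (Q₁ Q₂ : ℝ → ℝ³ → ℝ) (C : ℝ),
    IsTypeIAncientMild C V₁ → IsTypeIAncientMild C V₂ →
    IsClassicalNSSolutionOn (Iio (0 : ℝ)) 1 0 V₁ Q₁ → IsClassicalNSSolutionOn (Iio (0 : ℝ)) 1 0 V₂ Q₂ →
    ∀ t < 0, ∀ ρ : ℝ, 0 < ρ → (∀ x : ℝ³, ρ ≤ ‖x‖ → V₁ t x = V₂ t x) → ∀ x : ℝ³, V₁ t x = V₂ t x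

/-- **(L3) FREE VORTICITY RIGIDITY OUTSIDE THE HORIZON** — the certificate that the exterior obstruction is ONLY the
twin coupling (and the first thing a prover can land: it is the tree's ESS half-space backward uniqueness
`ess_backward_uniqueness_holds` applied on the cylinders `{x·e > R√t₁} × (0,t₁)` that exhaust the paraboloid exterior,
in ESS's forward orientation `t ∈ (0,1)`): a `C²` field on the open paraboloid exterior `{‖x‖ > R√t}` satisfying the
BACKWARD HEAT EQUATION there (no inequality slack needed), with Gaussian growth and zero trace at `t = 0` off the
origin, vanishes on the whole paraboloid exterior.  (For the curl of an all-orders-flat FREE Stokes twin difference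
this is exactly the input; the harmonic-gradient remainder is then killed by flatness, `Negative`-style bookkeeping.) -/
def FreeHeatParaboloidRigidity : Prop :=
  ∀ (m : ℕ) (R M : ℝ), 0 < R →
    ∀ θ : ℝ → ℝ³ → EuclideanSpace ℝ (Fin m),
      ContDiffOn ℝ 2 (uncurry θ) {z : ℝ × ℝ³ | z.1 ∈ Ioo (0 : ℝ) 1 ∧ R * Real.sqrt z.1 < ‖z.2‖} →
      ContinuousOn (uncurry θ) {z : ℝ × ℝ³ | z.1 ∈ Ico (0 : ℝ) 1 ∧ R * Real.sqrt z.1 < ‖z.2‖} →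
      (∀ t ∈ Ioo (0 : ℝ) 1, ∀ x : ℝ³, R * Real.sqrt t < ‖x‖ → timeDeriv θ t x + (Δ (θ t)) x = 0) →
      (∀ t ∈ Ioo (0 : ℝ) 1, ∀ x : ℝ³, R * Real.sqrt t < ‖x‖ → ‖θ t x‖ ≤ Real.exp (M * ‖x‖ ^ 2)) →
      (∀ x : ℝ³, x ≠ 0 → θ 0 x = 0) →
      ∀ t ∈ Ioo (0 : ℝ) 1, ∀ x : ℝ³, R * Real.sqrt t < ‖x‖ → θ t x = 0

/-! ## Glue (pure logic): how (L1)+(L2) close FSR, hence — with AOF — the crux via the landed reduction. -/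

/-- (L1) ∧ (L2) ⟹ ExteriorTwinVanishing. -/
theorem exteriorTwinVanishing_of_paraboloid_of_uc
    (hP : ParaboloidExteriorTwinVanishing) (hUC : TwinSpatialUniqueContinuation) :
    ExteriorTwinVanishing := by
  intro V₁ V₂ Q₁ Q₂ C hC hm₁ hm₂ hd₁ hd₂ hcl₁ hcl₂ hB₁ hB₂ _ _ hflat R _hR t ht x _hx
  obtain ⟨R₀, hR₀, h⟩ := hP C hC
  have hρ : 0 < R₀ * Real.sqrt (-t) := mul_pos hR₀ (Real.sqrt_pos.2 (by linarith))
  exact hUC V₁ V₂ Q₁ Q₂ C hm₁ hm₂ hcl₁ hcl₂ t ht (R₀ * Real.sqrt (-t)) hρ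
    (fun y hy => h V₁ V₂ Q₁ Q₂ hm₁ hm₂ hd₁ hd₂ hcl₁ hcl₂ hB₁ hB₂ hflat t ht y hy) x

/-- ExteriorTwinVanishing ⟹ FSR (agreement off the origin at radius `‖x‖` itself; at the origin by continuity of the
classical twins on the open past). -/
theorem fsr_of_exteriorTwinVanishing (hE : ExteriorTwinVanishing) : FSR := by
  intro V₁ V₂ Q₁ Q₂ C hC hm₁ hm₂ hd₁ hd₂ hcl₁ hcl₂ hB₁ hB₂ hs₁ hs₂ hflat t ht x
  have key : ∀ y : ℝ³, y ≠ 0 → V₁ t y = V₂ t y := fun y hy =>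
    hE V₁ V₂ Q₁ Q₂ C hC hm₁ hm₂ hd₁ hd₂ hcl₁ hcl₂ hB₁ hB₂ hs₁ hs₂ hflat ‖y‖ (norm_pos_iff.2 hy) t ht y le_rfl
  by_cases hx : x = 0
  · -- continuity at the origin: both slices are continuous (smooth on the open past), equal on the punctured space
    subst hx
    have hc₁ : Continuous (V₁ t) := by
      have h := hm₁.1.continuousOn
      have : ContinuousOn (fun y : ℝ³ => uncurry V₁ (t, y)) univ := by
        refine h.comp (Continuous.continuousOn (by fun_prop)) ?_
        intro y _; exact ⟨ht, mem_univ _⟩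
      simpa [continuousOn_univ, uncurry] using this
    have hc₂ : Continuous (V₂ t) := by
      have h := hm₂.1.continuousOn
      have : ContinuousOn (fun y : ℝ³ => uncurry V₂ (t, y)) univ := by
        refine h.comp (Continuous.continuousOn (by fun_prop)) ?_
        intro y _; exact ⟨ht, mem_univ _⟩
      simpa [continuousOn_univ, uncurry] using this
    -- closed set {y | V₁ t y = V₂ t y} contains the dense punctured space
    have hclosed : IsClosed {y : ℝ³ | V₁ t y = V₂ t y} := isClosed_eq hc₁ hc₂
    have hdense : Dense ({0}ᶜ : Set ℝ³) := dense_compl_singleton 0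
    have hsub : ({0}ᶜ : Set ℝ³) ⊆ {y : ℝ³ | V₁ t y = V₂ t y} := fun y hy => key y hy
    have : (0 : ℝ³) ∈ {y : ℝ³ | V₁ t y = V₂ t y} := by
      have hcl : closure ({0}ᶜ : Set ℝ³) ⊆ {y | V₁ t y = V₂ t y} := hclosed.closure_subset_iff.2 hsub
      exact hcl (hdense.closure_eq ▸ mem_univ _)
    exact this
  · exact key x hx

end Summit.NavierStokesRegularity.NavierStokesRegularity.Cruxes.ScarRigidity.SketchIdeator4

end
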